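import Summits.AtomisticToContinuum.BoseEinsteinCondensation.Theses.BECInfraredBound
import Summits.AtomisticToContinuum.BoseEinsteinCondensation.Cruxes.BecDepletionSplit.Lines.birth

/-!
# Sketch for crux-ideate stmt-AtomisticToContinuum-9026 (`BecDepletionSplit`), ideator 1

Toy experiment for the crux idea card `nearmin-filter`: the δ-near-minimiser clause of the route is
`Filter.Eventually` along an honest filter `nearMin v N L := ⨅ δ > 0, 𝓟 {Ψ | energy v Ψ ≤ E₀ + δ}`
(with a basis), and the small-density clause `∃ ρ₀ > 0, ∀ ρ ∈ (0, ρ₀), …` is `∀ᶠ ρ in 𝓝[>] 0, …`;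
the crux becomes `filter_upwards` ×3 + one pointwise cover inequality + the `θ⁺ = max θ 0` clip
(transfer target `depletionSplit_filter`, stated for an ABSTRACT nonnegative lattice family `F`).

Contents: the cover inequality (two compiled proofs: set surgery / pointwise majorant), the threshold
arithmetic, the filter `nearMin` + basis + the two dictionaries, `condensateNumber = liminf maxOccupation
(nearMin)` (the filter is the sub-problem's native object), the abstract transfer target, the crux
BY NAME (`BecDepletionSplit_of_filter`, no sorry, axioms propext/Classical.choice/Quot.sound), the third
birth stub verbatim (`nearMinCombine`), and the plug-in through the registered birth composition.
-/

noncomputable section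

open Filter Set
open scoped ENNReal NNReal BigOperators Topology

namespace Summit.AtomisticToContinuum.BoseEinsteinCondensation.Cruxes.BecDepletionSplit.IdeaSketch

open Literature.MathematicalPhysics.QuantumManyBody.BoseGas
open Summit.AtomisticToContinuum.BoseEinsteinCondensation.Theses.BECInfraredBound (BecDepletionSplit)

/-! ## Part B first (used by Part A): the lattice tsum split and the threshold arithmetic -/

/-- Cover inequality `Σ'_{k≠0} f ≤ Σ'_{k≠0, ‖k‖≤R} f + Σ'_{R<‖k‖} f`, proof 1: set surgery
(`ENNReal.tsum_mono_subtype` + `ENNReal.tsum_union_le`). [folklore] -/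
theorem latticeTsumSplit (f : (Fin 3 → ℤ) → ℝ≥0∞) (R : ℝ) :
    ∑' k : {k : Fin 3 → ℤ // k ≠ 0}, f k.1 ≤
      (∑' k : {k : Fin 3 → ℤ // k ≠ 0 ∧ ‖(fun j => (k j : ℝ))‖ ≤ R}, f k.1) +
        ∑' k : {k : Fin 3 → ℤ // R < ‖(fun j => (k j : ℝ))‖}, f k.1 := by
  have hsub : ({k : Fin 3 → ℤ | k ≠ 0} : Set (Fin 3 → ℤ)) ⊆
      {k | k ≠ 0 ∧ ‖(fun j => (k j : ℝ))‖ ≤ R} ∪ {k | R < ‖(fun j => (k j : ℝ))‖} := by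
    intro k hk
    rcases le_or_gt ‖(fun j => (k j : ℝ))‖ R with h | h
    · exact Or.inl ⟨hk, h⟩
    · exact Or.inr h
  exact (ENNReal.tsum_mono_subtype f hsub).trans (ENNReal.tsum_union_le f _ _)

/-- Cover inequality, proof 2: pointwise majorant on the FULL lattice (the in-tree
`ModeCounting.condensate_ge_half` pattern): `tsum_subtype` turns the three subtype sums into
indicator sums over `ℤ³`, the inequality is pointwise, then `ENNReal.tsum_add`/`tsum_le_tsum`.
[folklore] -/
theorem latticeTsumSplit' (f : (Fin 3 → ℤ) → ℝ≥0∞) (R : ℝ) :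
    ∑' k : {k : Fin 3 → ℤ // k ≠ 0}, f k.1 ≤
      (∑' k : {k : Fin 3 → ℤ // k ≠ 0 ∧ ‖(fun j => (k j : ℝ))‖ ≤ R}, f k.1) +
        ∑' k : {k : Fin 3 → ℤ // R < ‖(fun j => (k j : ℝ))‖}, f k.1 := by
  have h0 := tsum_subtype ({k : Fin 3 → ℤ | k ≠ 0} : Set (Fin 3 → ℤ)) f
  have h1 := tsum_subtype ({k : Fin 3 → ℤ | k ≠ 0 ∧ ‖(fun j => (k j : ℝ))‖ ≤ R} : Set (Fin 3 → ℤ)) f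
  have h2 := tsum_subtype ({k : Fin 3 → ℤ | R < ‖(fun j => (k j : ℝ))‖} : Set (Fin 3 → ℤ)) f
  refine (le_of_eq h0).trans (le_trans ?_ (le_of_eq (congrArg₂ (· + ·) h1.symm h2.symm)))
  rw [← ENNReal.tsum_add]
  refine ENNReal.tsum_le_tsum fun k => ?_
  by_cases hk : k = 0
  · simp [Set.indicator, hk]
  · rcases le_or_gt ‖(fun j => (k j : ℝ))‖ R with h | h
    · simp [Set.indicator, hk, h]
    · simp [Set.indicator, hk, h, not_le.2 h]

/-- Threshold arithmetic with the corner `θ ≤ 0` (clip `θ⁺ := max θ 0`). [folklore] -/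
theorem thresholdCombine (θ : ℝ) (hθ : θ < 1) :
    ∃ η : ℝ, 0 < η ∧ ∃ θ' : ℝ, θ' < 1 ∧ ∀ (N : ℕ) (a b : ℝ≥0∞),
      a ≤ ENNReal.ofReal (η * N) → b ≤ ENNReal.ofReal (θ * N) → a + b ≤ ENNReal.ofReal (θ' * N) := by
  have hp0 : 0 ≤ max θ 0 := le_max_right _ _
  have hp1 : max θ 0 < 1 := max_lt hθ one_pos
  refine ⟨(1 - max θ 0) / 2, by linarith, (1 + max θ 0) / 2, by linarith, ?_⟩
  intro N a b ha hb
  have hN : (0 : ℝ) ≤ N := Nat.cast_nonneg N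
  calc a + b ≤ ENNReal.ofReal ((1 - max θ 0) / 2 * N) + ENNReal.ofReal (max θ 0 * N) :=
        add_le_add ha (hb.trans (ENNReal.ofReal_le_ofReal
          (mul_le_mul_of_nonneg_right (le_max_left _ _) hN)))
    _ = ENNReal.ofReal ((1 - max θ 0) / 2 * N + max θ 0 * N) :=
        (ENNReal.ofReal_add (by positivity) (by positivity)).symm
    _ = ENNReal.ofReal ((1 + max θ 0) / 2 * N) := by congr 1; ring

/-! ## Part A: the near-minimiser filter -/

/-- The **near-minimiser filter** of the Dirichlet `N`-body problem in the box of side `L`: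
generated by the sub-level sets `{Ψ | ⟨Ψ,HΨ⟩ ≤ E₀ + δ}`, `δ > 0`. [folklore] -/
def nearMin (v : ℝ → ℝ≥0∞) (N : ℕ) (L : ℝ) : Filter (TrialState N L) :=
  ⨅ (δ : ℝ≥0∞) (_ : 0 < δ), 𝓟 {Ψ | energy v Ψ ≤ groundStateEnergy v N L + δ}

/-- The sub-level sets form a basis of `nearMin` (directed under `min`). [folklore] -/
theorem hasBasis_nearMin (v : ℝ → ℝ≥0∞) (N : ℕ) (L : ℝ) :
    (nearMin v N L).HasBasis (fun δ : ℝ≥0∞ => 0 < δ)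
      (fun δ => {Ψ | energy v Ψ ≤ groundStateEnergy v N L + δ}) := by
  refine Filter.hasBasis_biInf_principal' ?_ ⟨1, one_pos⟩
  intro δ₁ h₁ δ₂ h₂
  refine ⟨min δ₁ δ₂, lt_min h₁ h₂, ?_, ?_⟩
  · exact fun Ψ (hΨ : energy v Ψ ≤ _) => hΨ.trans (add_le_add le_rfl (min_le_left _ _))
  · exact fun Ψ (hΨ : energy v Ψ ≤ _) => hΨ.trans (add_le_add le_rfl (min_le_right _ _))

/-- **First lemma of the card (dictionary 1).** Eventually along `nearMin` is verbatim the route's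
`∃ δ > 0, ∀ Ψ, energy v Ψ ≤ E₀ + δ → P Ψ`. [folklore] -/
theorem eventually_nearMin_iff {v : ℝ → ℝ≥0∞} {N : ℕ} {L : ℝ} {P : TrialState N L → Prop} :
    (∀ᶠ Ψ in nearMin v N L, P Ψ) ↔
      ∃ δ : ℝ≥0∞, 0 < δ ∧ ∀ Ψ : TrialState N L,
        energy v Ψ ≤ groundStateEnergy v N L + δ → P Ψ := by
  rw [(hasBasis_nearMin v N L).eventually_iff]
  simp only [Set.mem_setOf_eq]

/-- **Dictionary 2.** The small-density clause is `∀ᶠ ρ in 𝓝[>] 0`. [folklore] -/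
theorem eventually_smallDensity_iff {P : ℝ → Prop} :
    (∀ᶠ ρ in 𝓝[>] (0 : ℝ), P ρ) ↔ ∃ ρ₀ : ℝ, 0 < ρ₀ ∧ ∀ ρ : ℝ, 0 < ρ → ρ < ρ₀ → P ρ := by
  rw [(nhdsGT_basis (0 : ℝ)).eventually_iff]
  simp only [Set.mem_Ioo, and_imp]

/-- The filter is the sub-problem's native object: `condensateNumber` (the `λ_max` **of the ground
state**, LSSY (1.17)–(1.19)) is the `liminf` of `λ_max(γ_Ψ)` along `nearMin`. [folklore] -/
theorem condensateNumber_eq_liminf (v : ℝ → ℝ≥0∞) (N : ℕ) (L : ℝ) :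
    condensateNumber v N L =
      Filter.liminf (fun Ψ : TrialState N L => maxOccupation N Ψ.ψ) (nearMin v N L) := by
  rw [(hasBasis_nearMin v N L).liminf_eq_iSup_iInf]
  simp only [Set.mem_setOf_eq, condensateNumber]

/-- **Transfer target C⁺ (abstract family, filter form).** For ANY nonnegative lattice family
`F ε ρ N Ψ k` (not only inner-mode occupations): window count + ultraviolet tail ⇒ depletion,
with `θ' = (1 + max θ 0)/2`. Proof = clip, `filter_upwards` ×3, cover inequality, add.
[folklore] -/
theorem depletionSplit_filter (v : ℝ → ℝ≥0∞)
    (F : (ε ρ : ℝ) → (N : ℕ) → TrialState N (sideLength ρ N) → (Fin 3 → ℤ) → ℝ≥0∞)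
    (hW : ∀ ε : ℝ, 0 < ε → ε < 1 / 4 → ∀ K : ℝ, 0 < K → ∀ η : ℝ, 0 < η →
      ∀ᶠ ρ in 𝓝[>] (0 : ℝ), ∀ᶠ N in atTop, ∀ᶠ Ψ in nearMin v N (sideLength ρ N),
        ∑' k : {k : Fin 3 → ℤ // k ≠ 0 ∧ ‖(fun j => (k j : ℝ))‖ ≤ K * Real.sqrt ρ * sideLength ρ N},
          F ε ρ N Ψ k.1 ≤ ENNReal.ofReal (η * N))
    (hU : ∃ K : ℝ, 0 < K ∧ ∃ θ : ℝ, θ < 1 ∧ ∀ ε : ℝ, 0 < ε → ε < 1 / 4 →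
      ∀ᶠ ρ in 𝓝[>] (0 : ℝ), ∀ᶠ N in atTop, ∀ᶠ Ψ in nearMin v N (sideLength ρ N),
        ∑' k : {k : Fin 3 → ℤ // K * Real.sqrt ρ * sideLength ρ N < ‖(fun j => (k j : ℝ))‖},
          F ε ρ N Ψ k.1 ≤ ENNReal.ofReal (θ * N)) :
    ∃ θ' : ℝ, θ' < 1 ∧ ∀ ε : ℝ, 0 < ε → ε < 1 / 4 →
      ∀ᶠ ρ in 𝓝[>] (0 : ℝ), ∀ᶠ N in atTop, ∀ᶠ Ψ in nearMin v N (sideLength ρ N),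
        ∑' k : {k : Fin 3 → ℤ // k ≠ 0}, F ε ρ N Ψ k.1 ≤ ENNReal.ofReal (θ' * N) := by
  obtain ⟨K, hK, θ, hθ, hUε⟩ := hU
  obtain ⟨η, hη, θ', hθ', hadd⟩ := thresholdCombine θ hθ
  refine ⟨θ', hθ', fun ε hε hε' => ?_⟩
  filter_upwards [hW ε hε hε' K hK η hη, hUε ε hε hε'] with ρ hWρ hUρ
  filter_upwards [hWρ, hUρ] with N hWN hUN
  filter_upwards [hWN, hUN] with Ψ hA hB
  exact (latticeTsumSplit (F ε ρ N Ψ) (K * Real.sqrt ρ * sideLength ρ N)).trans (hadd N _ _ hA hB)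

/-! ## The crux BY NAME from C⁺ via the two dictionaries -/

/-- Verbatim the inner box of the crux. -/
abbrev innerBox (ε L : ℝ) : Set (EuclideanSpace ℝ (Fin 3)) :=
  {x : EuclideanSpace ℝ (Fin 3) | ∀ j, x j ∈ Set.Ioo (ε * L) (L - ε * L)}

/-- Verbatim the inner-box plane wave of the crux. -/
abbrev innerMode (ε L : ℝ) (k : Fin 3 → ℤ) : EuclideanSpace ℝ (Fin 3) → ℂ :=
  (innerBox ε L).indicator fun x =>
    ((Real.sqrt (((1 - 2 * ε) * L) ^ 3))⁻¹ : ℂ) *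
      Complex.exp (Complex.I * ↑(2 * Real.pi / ((1 - 2 * ε) * L) * ∑ j, (k j : ℝ) * x j))

/-- The route decl from the abstract filter statement: instantiate `F := ` inner-mode occupation and
translate each clause with the two dictionaries (`simp only`). -/
theorem BecDepletionSplit_of_filter : BecDepletionSplit := by
  intro v _hv hW hU
  have key := depletionSplit_filter v
    (fun ε ρ N Ψ k => occupation N (innerMode ε (sideLength ρ N) k) Ψ.ψ) ?_ ?_
  · obtain ⟨θ', hθ', h⟩ := key
    refine ⟨θ', hθ', fun ε hε hε' => ?_⟩
    have h1 := h ε hε hε'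
    simp only [eventually_smallDensity_iff, eventually_nearMin_iff] at h1
    exact h1
  · intro ε hε hε' K hK η hη
    simp only [eventually_smallDensity_iff, eventually_nearMin_iff]
    exact hW ε hε hε' K hK η hη
  · obtain ⟨K, hK, θ, hθ, h⟩ := hU
    refine ⟨K, hK, θ, hθ, fun ε hε hε' => ?_⟩
    simp only [eventually_smallDensity_iff, eventually_nearMin_iff]
    exact h ε hε hε'


/-! ## The third birth stub, verbatim: the near-minimiser clause combinator is `filter_upwards` ×3 -/

/-- **Birth stub 3 (`stub_nearMinCombine`), exact signature.** Two small-density/near-minimiser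
clauses combine along a pointwise implication `P → Q → R`. With the two dictionaries the clause is
`∀ᶠ ρ in 𝓝[>] 0, ∀ᶠ N in atTop, ∀ᶠ Ψ in nearMin v N L_{ρ,N}, _`, and the statement is
`Filter.Eventually.mp` three times. [folklore] -/
theorem nearMinCombine :
    ∀ (v : ℝ → ℝ≥0∞)
      (P Q R : (ρ : ℝ) → (N : ℕ) → TrialState N (sideLength ρ N) → Prop),
      (∀ ρ N Ψ, P ρ N Ψ → Q ρ N Ψ → R ρ N Ψ) →
      (∃ ρ₀ : ℝ, 0 < ρ₀ ∧ ∀ ρ : ℝ, 0 < ρ → ρ < ρ₀ → ∀ᶠ N : ℕ in Filter.atTop, ∃ δ : ℝ≥0∞, 0 < δ ∧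
        ∀ Ψ : TrialState N (sideLength ρ N),
          energy v Ψ ≤ groundStateEnergy v N (sideLength ρ N) + δ → P ρ N Ψ) →
      (∃ ρ₀ : ℝ, 0 < ρ₀ ∧ ∀ ρ : ℝ, 0 < ρ → ρ < ρ₀ → ∀ᶠ N : ℕ in Filter.atTop, ∃ δ : ℝ≥0∞, 0 < δ ∧
        ∀ Ψ : TrialState N (sideLength ρ N),
          energy v Ψ ≤ groundStateEnergy v N (sideLength ρ N) + δ → Q ρ N Ψ) →
      ∃ ρ₀ : ℝ, 0 < ρ₀ ∧ ∀ ρ : ℝ, 0 < ρ → ρ < ρ₀ → ∀ᶠ N : ℕ in Filter.atTop, ∃ δ : ℝ≥0∞, 0 < δ ∧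
        ∀ Ψ : TrialState N (sideLength ρ N),
          energy v Ψ ≤ groundStateEnergy v N (sideLength ρ N) + δ → R ρ N Ψ := by
  intro v P Q R hPQR hP hQ
  simp only [← eventually_nearMin_iff, ← eventually_smallDensity_iff] at hP hQ ⊢
  filter_upwards [hP, hQ] with ρ hPρ hQρ
  filter_upwards [hPρ, hQρ] with N hPN hQN
  filter_upwards [hPN, hQN] with Ψ hPΨ hQΨ
  exact hPQR ρ N Ψ hPΨ hQΨ

/-! ## Plug-in check against the REGISTERED skeleton `Lines/birth.lean`

(The second `import` and this theorem exist only for this check; a prover landing the sketch as a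
`Theorems/` file drops both.)  The three theorems above have, up to unfolding the `Sig.*` names,
exactly the registered stub signatures, so they feed the kernel-checked birth composition: -/

/-- The crux once more, through the registered composition `Birth.BecDepletionSplit_of` fed with
`latticeTsumSplit`, `thresholdCombine`, `nearMinCombine` (all three birth stubs closed). -/
theorem BecDepletionSplit_via_birth : BecDepletionSplit :=
  Birth.BecDepletionSplit_of latticeTsumSplit thresholdCombine nearMinCombine

end Summit.AtomisticToContinuum.BoseEinsteinCondensation.Cruxes.BecDepletionSplit.IdeaSketch

end
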